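import Mathlib.Analysis.Complex.CauchyIntegral
import Mathlib.Analysis.SpecialFunctions.Complex.LogDeriv
import Mathlib.MeasureTheory.Integral.DominatedConvergence
import HarnessLib

/-!
# Boundary integrals of holomorphic functions on the upper half-plane along a rectangle

Topic `Literature/Analysis/Complex` (namespace `Literature.Analysis.Complex.BoundaryContour`).
Everything here is PROVED; no definition and no named fact is introduced.

For a function `F` holomorphic on the open upper half-plane `ℍ₊ = {Im z > 0}` consider the square
`[-R, R] × [0, R]`. Cauchy's theorem on the rectangles `[-R, R] × [δ, R]`, `0 < δ < R`
(Mathlib's `Complex.integral_boundary_rect_eq_zero_of_differentiableOn`) expresses the integral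
of `F` along the horizontal segment `Im z = δ` through the *three upper sides*

  `T(F, R) := ∫_{-R}^{R} F(x + iR) dx - i ∫_0^R F(R + iy) dy + i ∫_0^R F(-R + iy) dy`

(the integral of `F` along the path `-R → -R + iR → R + iR → R`). Main statements:

* `integral_boundaryValues_eq_threeSides` — if `F` is bounded on `[-R, R] × (0, R]` and has
  boundary values `g(x) = lim_{δ → 0⁺} F(x + iδ)` for almost every `x ∈ [-R, R]`, then
  `∫_{-R}^{R} g = T(F, R)` (dominated convergence as `δ → 0⁺`).
* `threeSides_eq_sub_of_hasDerivAt` — if `φ` has a primitive `Φ` along the three sides then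
  `T(φ, R) = Φ(R) - Φ(-R)`; `norm_threeSides_le` — `‖T(φ, R)‖ ≤ 4 R C` when `‖φ‖ ≤ C` on the
  sides.
* The branch `logU u = log(-iu) + iπ/2` of the logarithm, holomorphic off the closed negative
  imaginary axis (so on a neighbourhood of the closed upper half-plane minus `0`), with
  `exp (logU u) = u`, `logU R = log R`, `logU (-R) = log R + iπ` (`R > 0`), derivative `1/u`;
  and the resulting values of the three-sides integrals of the powers `u^q := exp (q logU u)`:
  `T(u^q, R) = (R^{q+1} - e^{iπ(q+1)} R^{q+1})/(q+1)` for `q ≠ -1` and `T(u^{-1}, R) = -iπ`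
  (`threeSides_cexp_mul_logU`, `threeSides_cexp_neg_logU`).

These are the contour-integration inputs of the proof of Rokhlin's complex orientation formula in
integrated form (`Literature/AlgebraicGeometry/RealAlgebraic/ComplexOrientationFormula.lean`):
there `F` is a signed sum of the sheets of a real plane curve over the upper half-plane, `g` its
boundary values, and near infinity `F` is a finite sum of Puiseux monomials `u^q`. [folklore]

## References

* L. V. Ahlfors, *Complex Analysis*, 3rd ed. (1979), Ch. 4 §§1.3–1.4 (Cauchy's theorem for a
  rectangle; line integrals of exact differentials). [folklore]
-/

noncomputable section

open Complex MeasureTheory Set Filter intervalIntegral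
open scoped Topology Real

namespace Literature.Analysis.Complex

namespace BoundaryContour

/-! ### The three upper sides of the square `[-R, R] × [0, R]` -/

/-- **Exact differentials along the three upper sides.** If `Φ` has derivative `φ` at every point
of the top side `Im z = R` and of the vertical sides `Re z = ±R` of the square `[-R, R] × [0, R]`,
and `φ` is continuous along them, then
`∫_{-R}^{R} φ(x + iR) dx - i∫_0^R φ(R + iy) dy + i∫_0^R φ(-R + iy) dy = Φ(R) - Φ(-R)`. [folklore] -/
theorem threeSides_eq_sub_of_hasDerivAt {Φ φ : ℂ → ℂ} {R : ℝ}
    (htop : ∀ x ∈ uIcc (-R) R, HasDerivAt Φ (φ (x + R * I)) (x + R * I))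
    (hright : ∀ y ∈ uIcc (0 : ℝ) R, HasDerivAt Φ (φ (R + y * I)) (R + y * I))
    (hleft : ∀ y ∈ uIcc (0 : ℝ) R, HasDerivAt Φ (φ (-R + y * I)) (-R + y * I))
    (hφtop : ContinuousOn (fun x : ℝ => φ (x + R * I)) (uIcc (-R) R))
    (hφright : ContinuousOn (fun y : ℝ => φ (R + y * I)) (uIcc (0 : ℝ) R))
    (hφleft : ContinuousOn (fun y : ℝ => φ (-R + y * I)) (uIcc (0 : ℝ) R)) :
    (∫ x in (-R : ℝ)..R, φ (x + R * I)) - I • (∫ y in (0 : ℝ)..R, φ (R + y * I)) +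
        I • (∫ y in (0 : ℝ)..R, φ (-R + y * I)) = Φ R - Φ (-R) := by
  -- top side
  have htop' : ∫ x in (-R : ℝ)..R, φ (x + R * I) = Φ (R + R * I) - Φ (-R + R * I) := by
    have h := integral_eq_sub_of_hasDerivAt (f := fun x : ℝ => Φ (x + R * I))
      (f' := fun x : ℝ => φ (x + R * I)) (a := -R) (b := R)
      (fun x hx => ((htop x hx).comp_add_const (x : ℂ) (R * I)).comp_ofReal)
      (hφtop.intervalIntegrable)
    simpa using h
  -- vertical sides
  have hvert : ∀ a : ℝ, (∀ y ∈ uIcc (0 : ℝ) R, HasDerivAt Φ (φ (a + y * I)) (a + y * I)) →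
      ContinuousOn (fun y : ℝ => φ (a + y * I)) (uIcc (0 : ℝ) R) →
      I • (∫ y in (0 : ℝ)..R, φ (a + y * I)) = Φ (a + R * I) - Φ a := by
    intro a ha hc
    have hder : ∀ y ∈ uIcc (0 : ℝ) R,
        HasDerivAt (fun y : ℝ => Φ (a + y * I)) (φ (a + y * I) * I) y := by
      intro y hy
      have hin : HasDerivAt (fun z : ℂ => (a : ℂ) + z * I) I (y : ℂ) := by
        simpa using ((hasDerivAt_id (y : ℂ)).mul_const I).const_add (a : ℂ)
      exact ((ha y hy).comp (y : ℂ) hin).comp_ofReal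
    have h := integral_eq_sub_of_hasDerivAt hder ((hc.mul continuousOn_const).intervalIntegrable)
    rw [intervalIntegral.integral_mul_const] at h
    rw [smul_eq_mul, mul_comm, h]
    simp
  have hr := hvert R hright hφright
  have hl := hvert (-R) (by simpa using hleft) (by simpa using hφleft)
  rw [htop', hr]
  rw [show ((-R : ℝ) : ℂ) = -(R : ℂ) from ofReal_neg R] at hl
  rw [hl]
  ring

/-- **Length estimate for the three upper sides**: if `‖φ‖ ≤ C` on the three sides then
`‖∫_{-R}^{R} φ(x + iR) dx - i∫_0^R φ(R + iy) dy + i∫_0^R φ(-R + iy) dy‖ ≤ 4 R C`. [folklore] -/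
theorem norm_threeSides_le {φ : ℂ → ℂ} {R C : ℝ} (hR : 0 ≤ R)
    (htop : ∀ x ∈ uIcc (-R) R, ‖φ (x + R * I)‖ ≤ C)
    (hright : ∀ y ∈ uIcc (0 : ℝ) R, ‖φ (R + y * I)‖ ≤ C)
    (hleft : ∀ y ∈ uIcc (0 : ℝ) R, ‖φ (-R + y * I)‖ ≤ C) :
    ‖(∫ x in (-R : ℝ)..R, φ (x + R * I)) - I • (∫ y in (0 : ℝ)..R, φ (R + y * I)) +
        I • (∫ y in (0 : ℝ)..R, φ (-R + y * I))‖ ≤ 4 * R * C := by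
  have h1 : ‖∫ x in (-R : ℝ)..R, φ (x + R * I)‖ ≤ C * |R - -R| :=
    norm_integral_le_of_norm_le_const fun x hx => htop x (uIoc_subset_uIcc hx)
  have h2 : ‖∫ y in (0 : ℝ)..R, φ (R + y * I)‖ ≤ C * |R - 0| :=
    norm_integral_le_of_norm_le_const fun y hy => hright y (uIoc_subset_uIcc hy)
  have h3 : ‖∫ y in (0 : ℝ)..R, φ (-R + y * I)‖ ≤ C * |R - 0| :=
    norm_integral_le_of_norm_le_const fun y hy => hleft y (uIoc_subset_uIcc hy)
  rw [sub_neg_eq_add, abs_of_nonneg (by linarith)] at h1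
  rw [sub_zero, abs_of_nonneg hR] at h2 h3
  calc ‖(∫ x in (-R : ℝ)..R, φ (x + R * I)) - I • (∫ y in (0 : ℝ)..R, φ (R + y * I)) +
        I • (∫ y in (0 : ℝ)..R, φ (-R + y * I))‖
      ≤ ‖∫ x in (-R : ℝ)..R, φ (x + R * I)‖ + ‖I • (∫ y in (0 : ℝ)..R, φ (R + y * I))‖ +
        ‖I • (∫ y in (0 : ℝ)..R, φ (-R + y * I))‖ := norm_add_le_of_le (norm_sub_le _ _) le_rfl
    _ ≤ C * (R + R) + C * R + C * R := by
        rw [norm_smul, norm_smul, norm_I, one_mul, one_mul]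
        exact add_le_add (add_le_add h1 h2) h3
    _ = 4 * R * C := by ring

/-! ### Boundary values: `δ → 0⁺` by dominated convergence -/

/-- **Boundary integral through the three upper sides.** Let `F` be holomorphic on the open upper
half-plane, bounded on `[-R, R] × (0, R]`, with boundary values `g(x) = lim_{δ→0⁺} F(x + iδ)`
for almost every `x ∈ [-R, R]` (`R > 0`). Then
`∫_{-R}^{R} g = ∫_{-R}^{R} F(x + iR) dx - i∫_0^R F(R + iy) dy + i∫_0^R F(-R + iy) dy`.
(Cauchy on `[-R, R] × [δ, R]` and dominated convergence on the bottom side; on the vertical sides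
the integrals over `[δ, R]` converge to those over `[0, R]` by boundedness.) [folklore] -/
theorem integral_boundaryValues_eq_threeSides {F : ℂ → ℂ} {g : ℝ → ℂ} {R B : ℝ} (hR : 0 < R)
    (hF : DifferentiableOn ℂ F {z : ℂ | 0 < z.im})
    (hB : ∀ z : ℂ, |z.re| ≤ R → 0 < z.im → z.im ≤ R → ‖F z‖ ≤ B)
    (hg : ∀ᵐ x : ℝ, x ∈ uIoc (-R) R →
      Tendsto (fun δ : ℝ => F (x + δ * I)) (𝓝[>] 0) (𝓝 (g x))) :
    ∫ x in (-R : ℝ)..R, g x =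
      (∫ x in (-R : ℝ)..R, F (x + R * I)) - I • (∫ y in (0 : ℝ)..R, F (R + y * I)) +
        I • (∫ y in (0 : ℝ)..R, F (-R + y * I)) := by
  have hFc : ContinuousOn F {z : ℂ | 0 < z.im} := hF.continuousOn
  -- Cauchy on `[-R, R] × [δ, R]`
  have hrect : ∀ δ : ℝ, 0 < δ → δ < R →
      (∫ x in (-R : ℝ)..R, F (x + δ * I)) =
        (∫ x in (-R : ℝ)..R, F (x + R * I)) - I • (∫ y in δ..R, F (R + y * I)) +
          I • (∫ y in δ..R, F (-R + y * I)) := by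
    intro δ hδ hδR
    have hsub : (uIcc (-R) R ×ℂ uIcc δ R) ⊆ {z : ℂ | 0 < z.im} := by
      intro z hz
      rw [mem_reProdIm, uIcc_of_le hδR.le] at hz
      exact hδ.trans_le hz.2.1
    have h := Complex.integral_boundary_rect_eq_zero_of_differentiableOn F (-R + δ * I) (R + R * I)
      (hF.mono (by simpa using hsub))
    simp only [add_re, ofReal_re, mul_re, I_re, mul_zero, ofReal_im, I_im, mul_one, sub_self,
      add_zero, add_im, mul_im, zero_add, neg_re, neg_im, neg_zero, ofReal_neg, smul_eq_mul] at h
    simp only [smul_eq_mul]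
    rw [← sub_eq_zero, ← h]
    ring
  -- the bottom side: dominated convergence
  have hbot : Tendsto (fun δ : ℝ => ∫ x in (-R : ℝ)..R, F (x + δ * I)) (𝓝[>] 0)
      (𝓝 (∫ x in (-R : ℝ)..R, g x)) := by
    have hev : ∀ᶠ δ : ℝ in 𝓝[>] 0, 0 < δ ∧ δ < R := by
      filter_upwards [self_mem_nhdsWithin, Ioo_mem_nhdsGT hR] with δ hδ hδ'
      exact ⟨hδ, hδ'.2⟩
    refine tendsto_integral_filter_of_dominated_convergence (fun _ => B) ?_ ?_
      intervalIntegrable_const ?_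
    · filter_upwards [hev] with δ hδ
      refine ContinuousOn.aestronglyMeasurable ?_ measurableSet_uIoc
      refine (hFc.comp (by fun_prop) ?_).mono uIoc_subset_uIcc
      intro x _
      simp [hδ.1]
    · filter_upwards [hev] with δ hδ
      refine Eventually.of_forall fun x hx => hB _ ?_ (by simp [hδ.1]) (by simp [hδ.2.le])
      rw [uIoc_of_le (by linarith)] at hx
      simp only [add_re, ofReal_re, mul_re, I_re, mul_zero, ofReal_im, I_im, mul_one, sub_self,
        add_zero]
      exact abs_le.2 ⟨hx.1.le, hx.2⟩
    · filter_upwards [hg] with x hx hxm using hx hxm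
  -- the vertical sides
  have hside : ∀ a : ℝ, |a| ≤ R → Tendsto (fun δ : ℝ => ∫ y in δ..R, F (a + y * I)) (𝓝[>] 0)
      (𝓝 (∫ y in (0 : ℝ)..R, F (a + y * I))) := by
    intro a ha
    have hint : ∀ s t : ℝ, 0 ≤ s → s ≤ t → t ≤ R →
        IntervalIntegrable (fun y : ℝ => F (a + y * I)) volume s t := by
      intro s t hs hst htR
      rw [intervalIntegrable_iff_integrableOn_Ioc_of_le hst]
      have hmeas : AEStronglyMeasurable (fun y : ℝ => F (a + y * I)) (volume.restrict (Ioc s t)) := by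
        refine ContinuousOn.aestronglyMeasurable ?_ measurableSet_Ioc
        refine hFc.comp (by fun_prop) ?_
        intro y hy
        simp only [mem_setOf_eq, add_im, ofReal_im, mul_im, ofReal_re, I_im, mul_one, I_re,
          mul_zero, add_zero, zero_add]
        exact hs.trans_lt hy.1
      refine Integrable.mono' (g := fun _ => B) (integrable_const B) hmeas ?_
      refine (ae_restrict_mem measurableSet_Ioc).mono fun y hy => hB _ ?_ ?_ ?_
      · simpa using ha
      · simp only [add_im, ofReal_im, mul_im, ofReal_re, I_im, mul_one, I_re, mul_zero, add_zero,
          zero_add]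
        exact hs.trans_lt hy.1
      · simp only [add_im, ofReal_im, mul_im, ofReal_re, I_im, mul_one, I_re, mul_zero, add_zero,
          zero_add]
        exact hy.2.trans htR
    have hsplit : ∀ δ : ℝ, 0 < δ → δ < R →
        ∫ y in δ..R, F (a + y * I) =
          (∫ y in (0 : ℝ)..R, F (a + y * I)) - ∫ y in (0 : ℝ)..δ, F (a + y * I) := by
      intro δ hδ hδR
      rw [← integral_add_adjacent_intervals (hint 0 δ le_rfl hδ.le hδR.le)
        (hint δ R hδ.le hδR.le le_rfl)]
      ring
    have hsmall : Tendsto (fun δ : ℝ => ∫ y in (0 : ℝ)..δ, F (a + y * I)) (𝓝[>] 0) (𝓝 0) := by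
      rw [tendsto_zero_iff_norm_tendsto_zero]
      have hbound : ∀ δ : ℝ, 0 < δ → δ < R → ‖∫ y in (0 : ℝ)..δ, F (a + y * I)‖ ≤ B * δ := by
        intro δ hδ hδR
        have h := norm_integral_le_of_norm_le_const (a := (0 : ℝ)) (b := δ) (C := B)
          (f := fun y : ℝ => F (a + y * I)) fun y hy => ?_
        · simpa [abs_of_pos hδ] using h
        · rw [uIoc_of_le hδ.le] at hy
          refine hB _ (by simpa using ha) ?_ ?_
          · simpa using hy.1
          · simp only [add_im, ofReal_im, mul_im, ofReal_re, I_im, mul_one, I_re, mul_zero,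
              add_zero, zero_add]
            exact hy.2.trans hδR.le
      have hlim : Tendsto (fun δ : ℝ => B * δ) (𝓝[>] 0) (𝓝 0) := by
        have : Tendsto (fun δ : ℝ => B * δ) (𝓝 0) (𝓝 (B * 0)) :=
          tendsto_const_nhds.mul tendsto_id
        rw [mul_zero] at this
        exact this.mono_left nhdsWithin_le_nhds
      refine squeeze_zero' (Eventually.of_forall fun δ => norm_nonneg _) ?_ hlim
      filter_upwards [self_mem_nhdsWithin, Ioo_mem_nhdsGT hR] with δ hδ hδ'
      exact hbound δ hδ hδ'.2
    have : Tendsto (fun δ : ℝ => (∫ y in (0 : ℝ)..R, F (a + y * I)) - ∫ y in (0 : ℝ)..δ, F (a + y * I))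
        (𝓝[>] 0) (𝓝 ((∫ y in (0 : ℝ)..R, F (a + y * I)) - 0)) := tendsto_const_nhds.sub hsmall
    rw [sub_zero] at this
    refine this.congr' ?_
    filter_upwards [self_mem_nhdsWithin, Ioo_mem_nhdsGT hR] with δ hδ hδ'
    exact (hsplit δ hδ hδ'.2).symm
  have hright := hside R (by rw [abs_of_pos hR])
  have hleft := hside (-R) (by rw [abs_neg, abs_of_pos hR])
  simp only [ofReal_neg] at hleft
  -- combine
  have hlim : Tendsto (fun δ : ℝ => ∫ x in (-R : ℝ)..R, F (x + δ * I)) (𝓝[>] 0)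
      (𝓝 ((∫ x in (-R : ℝ)..R, F (x + R * I)) - I • (∫ y in (0 : ℝ)..R, F (R + y * I)) +
        I • (∫ y in (0 : ℝ)..R, F (-R + y * I)))) := by
    have h := (tendsto_const_nhds (x := ∫ x in (-R : ℝ)..R, F (x + R * I))).sub
      (hright.const_smul I) |>.add (hleft.const_smul I)
    refine h.congr' ?_
    filter_upwards [self_mem_nhdsWithin, Ioo_mem_nhdsGT hR] with δ hδ hδ'
    exact (hrect δ hδ hδ'.2).symm
  exact tendsto_nhds_unique hbot hlim

/-! ### A logarithm on the closed upper half-plane minus the origin -/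

/-- `log(-iu) + iπ/2` is a branch of `log u` holomorphic off the closed negative imaginary axis:
it inverts `exp`. [folklore] -/
theorem exp_logU {u : ℂ} (hu : u ≠ 0) : exp (log (-I * u) + (π / 2 : ℝ) * I) = u := by
  rw [exp_add, exp_log (mul_ne_zero (neg_ne_zero.2 I_ne_zero) hu)]
  rw [show ((π / 2 : ℝ) : ℂ) * I = (π / 2 : ℂ) * I by push_cast; ring]
  rw [← log_I, exp_log I_ne_zero]
  rw [mul_comm (-I) u, mul_assoc, neg_mul, I_mul_I, neg_neg, mul_one]

/-- The branch at a positive real: `logU R = log R`. [folklore] -/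
theorem logU_ofReal {R : ℝ} (hR : 0 < R) :
    log (-I * R) + (π / 2 : ℝ) * I = (Real.log R : ℂ) := by
  rw [mul_comm, log_ofReal_mul hR (neg_ne_zero.2 I_ne_zero), log_neg_I]
  push_cast
  ring

/-- The branch at a negative real (reached from the upper half-plane): `logU (-R) = log R + iπ`.
[folklore] -/
theorem logU_neg_ofReal {R : ℝ} (hR : 0 < R) :
    log (-I * (-R : ℂ)) + (π / 2 : ℝ) * I = (Real.log R : ℂ) + π * I := by
  rw [show -I * (-(R : ℂ)) = R * I by ring, log_ofReal_mul hR I_ne_zero, log_I]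
  push_cast
  ring

/-- Real part of the branch: `Re logU u = log ‖u‖`. [folklore] -/
theorem re_logU (u : ℂ) : (log (-I * u) + (π / 2 : ℝ) * I).re = Real.log ‖u‖ := by
  simp [Complex.log_re]

/-- The points where the branch is holomorphic: `-iu` in the slit plane, i.e. `u` off the closed
negative imaginary axis; this contains the open upper half-plane and the non-zero reals.
[folklore] -/
theorem neg_I_mul_mem_slitPlane {u : ℂ} (hu : 0 < u.im ∨ (u.im = 0 ∧ u.re ≠ 0)) :
    -I * u ∈ slitPlane := by
  rw [mem_slitPlane_iff]
  simp only [neg_mul, neg_re, mul_re, I_re, zero_mul, I_im, one_mul, zero_sub, neg_neg, neg_im,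
    mul_im, zero_add, ne_eq, neg_eq_zero]
  rcases hu with h | ⟨_, h⟩
  · exact Or.inl h
  · exact Or.inr h

/-- Derivative of the branch: `(logU)' u = 1/u` off the closed negative imaginary axis. [folklore] -/
theorem hasDerivAt_logU {u : ℂ} (hu : -I * u ∈ slitPlane) :
    HasDerivAt (fun u : ℂ => log (-I * u) + (π / 2 : ℝ) * I) u⁻¹ u := by
  have hu0 : u ≠ 0 := by
    rintro rfl
    simp at hu
  have h1 : HasDerivAt (fun u : ℂ => -I * u) (-I) u := by
    simpa using (hasDerivAt_id u).const_mul (-I)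
  have h2 := (Complex.hasDerivAt_log hu).comp u h1
  have h3 : (-I * u)⁻¹ * -I = u⁻¹ := by
    field_simp
  rw [h3] at h2
  simpa using h2.add_const (((π / 2 : ℝ) : ℂ) * I)

/-- Derivative of the powers `u^q := exp (q · logU u)`: the primitive of `u^q` is
`u^{q+1}/(q+1)` (`q ≠ -1`). [folklore] -/
theorem hasDerivAt_cexp_mul_logU {u : ℂ} (hu : -I * u ∈ slitPlane) {q : ℂ} (hq : q + 1 ≠ 0) :
    HasDerivAt (fun u : ℂ => exp ((q + 1) * (log (-I * u) + (π / 2 : ℝ) * I)) / (q + 1))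
      (exp (q * (log (-I * u) + (π / 2 : ℝ) * I))) u := by
  have hu0 : u ≠ 0 := by
    rintro rfl
    simp at hu
  have h := (((hasDerivAt_logU hu).const_mul (q + 1)).cexp).div_const (q + 1)
  refine h.congr_deriv ?_
  have hL : exp ((q + 1) * (log (-I * u) + (π / 2 : ℝ) * I)) =
      exp (q * (log (-I * u) + (π / 2 : ℝ) * I)) * u := by
    rw [add_mul, one_mul, exp_add, exp_logU hu0]
  rw [hL]
  field_simp

/-- **Three-sides integral of `u^q`, `q ≠ -1`**:
`T(u^q, R) = (R^{q+1} - e^{iπ(q+1)} R^{q+1})/(q+1)` with `R^{q+1} = exp ((q+1) log R)`.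
[folklore] -/
theorem threeSides_cexp_mul_logU {R : ℝ} (hR : 0 < R) {q : ℂ} (hq : q + 1 ≠ 0) :
    (∫ x in (-R : ℝ)..R, exp (q * (log (-I * (x + R * I)) + (π / 2 : ℝ) * I))) -
      I • (∫ y in (0 : ℝ)..R, exp (q * (log (-I * (R + y * I)) + (π / 2 : ℝ) * I))) +
      I • (∫ y in (0 : ℝ)..R, exp (q * (log (-I * (-R + y * I)) + (π / 2 : ℝ) * I))) =
      (exp ((q + 1) * Real.log R) - exp ((q + 1) * (Real.log R + π * I))) / (q + 1) := by
  have hmem : ∀ z : ℂ, 0 ≤ z.im → z ≠ 0 → -I * z ∈ slitPlane := by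
    intro z hz hz0
    refine neg_I_mul_mem_slitPlane ?_
    rcases hz.lt_or_eq with h | h
    · exact Or.inl h
    · refine Or.inr ⟨h.symm, fun hre => hz0 (Complex.ext hre h.symm)⟩
  have hcont : ∀ f : ℝ → ℂ, Continuous f → ∀ x : ℝ, -I * f x ∈ slitPlane →
      ContinuousAt (fun y : ℝ => exp (q * (log (-I * f y) + (π / 2 : ℝ) * I))) x := by
    intro f hf x hx
    have h1 : ContinuousAt (fun u : ℂ => log (-I * u) + (π / 2 : ℝ) * I) (f x) :=
      (hasDerivAt_logU hx).continuousAt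
    exact ((h1.comp hf.continuousAt).const_mul q).cexp
  have htopmem : ∀ x : ℝ, -I * ((x : ℂ) + R * I) ∈ slitPlane := fun x =>
    hmem _ (by simp [hR.le]) (by
      intro h; have := congrArg Complex.im h; simp [hR.ne'] at this)
  have hsidemem : ∀ (a : ℝ), a ≠ 0 → ∀ y : ℝ, 0 ≤ y → -I * ((a : ℂ) + y * I) ∈ slitPlane := by
    intro a ha y hy
    refine hmem _ (by simp [hy]) ?_
    intro h; have := congrArg Complex.re h; simp [ha] at this
  have h := threeSides_eq_sub_of_hasDerivAt (R := R)
    (Φ := fun u : ℂ => exp ((q + 1) * (log (-I * u) + (π / 2 : ℝ) * I)) / (q + 1))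
    (φ := fun u : ℂ => exp (q * (log (-I * u) + (π / 2 : ℝ) * I)))
    (fun x _ => hasDerivAt_cexp_mul_logU (htopmem x) hq)
    (fun y hy => hasDerivAt_cexp_mul_logU (hsidemem R hR.ne' y (by
      rw [uIcc_of_le hR.le] at hy; exact hy.1)) hq)
    (fun y hy => by
      have := hasDerivAt_cexp_mul_logU (hsidemem (-R) (neg_ne_zero.2 hR.ne') y (by
        rw [uIcc_of_le hR.le] at hy; exact hy.1)) hq
      simpa using this)
    (by
      refine continuousOn_of_forall_continuousAt fun x _ => ?_
      exact hcont (fun x : ℝ => (x : ℂ) + R * I) (by fun_prop) x (htopmem x))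
    (by
      refine continuousOn_of_forall_continuousAt fun y hy => ?_
      rw [uIcc_of_le hR.le] at hy
      exact hcont (fun y : ℝ => (R : ℂ) + y * I) (by fun_prop) y (hsidemem R hR.ne' y hy.1))
    (by
      refine continuousOn_of_forall_continuousAt fun y hy => ?_
      rw [uIcc_of_le hR.le] at hy
      exact hcont (fun y : ℝ => -(R : ℂ) + y * I) (by fun_prop) y
        (by simpa using hsidemem (-R) (neg_ne_zero.2 hR.ne') y hy.1))
  rw [h, logU_ofReal hR, logU_neg_ofReal hR, sub_div]

/-- **Three-sides integral of `u^q` for a real exponent `q ≠ -1`**, in the form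
`R^{q+1} · (1 - e^{iπ(q+1)})/(q+1)` with the real power `R^{q+1}`. [folklore] -/
theorem threeSides_cexp_mul_logU_real {R : ℝ} (hR : 0 < R) {q : ℝ} (hq : q + 1 ≠ 0) :
    (∫ x in (-R : ℝ)..R, exp (q * (log (-I * (x + R * I)) + (π / 2 : ℝ) * I))) -
      I • (∫ y in (0 : ℝ)..R, exp (q * (log (-I * (R + y * I)) + (π / 2 : ℝ) * I))) +
      I • (∫ y in (0 : ℝ)..R, exp (q * (log (-I * (-R + y * I)) + (π / 2 : ℝ) * I))) =
      ((R ^ (q + 1) : ℝ) : ℂ) * ((1 - exp ((q + 1 : ℂ) * (π * I))) / (q + 1)) := by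
  have hq' : (q : ℂ) + 1 ≠ 0 := by exact_mod_cast hq
  rw [threeSides_cexp_mul_logU hR hq', Real.rpow_def_of_pos hR, ofReal_exp, mul_add, exp_add]
  push_cast
  ring

/-- **Three-sides integral of `u^{-1}`**: `T(u^{-1}, R) = logU R - logU (-R) = -iπ`. [folklore] -/
theorem threeSides_inv {R : ℝ} (hR : 0 < R) :
    (∫ x in (-R : ℝ)..R, ((x : ℂ) + R * I)⁻¹) - I • (∫ y in (0 : ℝ)..R, ((R : ℂ) + y * I)⁻¹) +
      I • (∫ y in (0 : ℝ)..R, (-(R : ℂ) + y * I)⁻¹) = -π * I := by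
  have hmem : ∀ z : ℂ, 0 ≤ z.im → z ≠ 0 → -I * z ∈ slitPlane := by
    intro z hz hz0
    refine neg_I_mul_mem_slitPlane ?_
    rcases hz.lt_or_eq with h | h
    · exact Or.inl h
    · refine Or.inr ⟨h.symm, fun hre => hz0 (Complex.ext hre h.symm)⟩
  have htopmem : ∀ x : ℝ, -I * ((x : ℂ) + R * I) ∈ slitPlane := fun x =>
    hmem _ (by simp [hR.le]) (by
      intro h; have := congrArg Complex.im h; simp [hR.ne'] at this)
  have hsidemem : ∀ (a : ℝ), a ≠ 0 → ∀ y : ℝ, 0 ≤ y → -I * ((a : ℂ) + y * I) ∈ slitPlane := by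
    intro a ha y hy
    refine hmem _ (by simp [hy]) ?_
    intro h; have := congrArg Complex.re h; simp [ha] at this
  have hne : ∀ z : ℂ, -I * z ∈ slitPlane → z ≠ 0 := by
    rintro z hz rfl
    simp at hz
  have hcont : ∀ f : ℝ → ℂ, Continuous f → ∀ x : ℝ, f x ≠ 0 →
      ContinuousAt (fun y : ℝ => (f y)⁻¹) x := fun f hf x hx =>
    (continuousAt_inv₀ hx).comp hf.continuousAt
  have h := threeSides_eq_sub_of_hasDerivAt (R := R)
    (Φ := fun u : ℂ => log (-I * u) + (π / 2 : ℝ) * I) (φ := fun u : ℂ => u⁻¹)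
    (fun x _ => hasDerivAt_logU (htopmem x))
    (fun y hy => hasDerivAt_logU (hsidemem R hR.ne' y (by
      rw [uIcc_of_le hR.le] at hy; exact hy.1)))
    (fun y hy => by
      have := hasDerivAt_logU (hsidemem (-R) (neg_ne_zero.2 hR.ne') y (by
        rw [uIcc_of_le hR.le] at hy; exact hy.1))
      simpa using this)
    (by
      refine continuousOn_of_forall_continuousAt fun x _ => ?_
      exact hcont (fun x : ℝ => (x : ℂ) + R * I) (by fun_prop) x (hne _ (htopmem x)))
    (by
      refine continuousOn_of_forall_continuousAt fun y hy => ?_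
      rw [uIcc_of_le hR.le] at hy
      exact hcont (fun y : ℝ => (R : ℂ) + y * I) (by fun_prop) y (hne _ (hsidemem R hR.ne' y hy.1)))
    (by
      refine continuousOn_of_forall_continuousAt fun y hy => ?_
      rw [uIcc_of_le hR.le] at hy
      exact hcont (fun y : ℝ => -(R : ℂ) + y * I) (by fun_prop) y
        (hne _ (by simpa using hsidemem (-R) (neg_ne_zero.2 hR.ne') y hy.1)))
  rw [h, logU_ofReal hR, logU_neg_ofReal hR]
  ring

end BoundaryContour

end Literature.Analysis.Complex
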